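import Summits.KontsevichZagierPeriods.KontsevichZagierPeriods.Theorems.HeckeMultiplicityOneManinStokesHalfPlaneMap

/-!
# `ManinStokes` (stmt-KontsevichZagierPeriods-5277): bookkeeping for Green's formula on the compactifying rectangle

Support file (prover-owned, `--supports stmt-KontsevichZagierPeriods-5277`; generic). Semialgebraicity of the maps
`x`, `x'`, `y`, `y'` and of compositions `F(x(wᵢ), y(wⱼ))` with a `ℚ`-semialgebraic `F` on the punctured closed
lower half plane (`IsSemialgebraicFunOn.comp_isSemialgebraicMapOn_holds`); null coordinate lines; the
two-dimensional change of variables `(t,s) ↦ (x(t), y(s))` giving integrability of the bulk integrand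
`−im G'(x(t)+iy(s)) y'(s) x'(t)` on the open rectangle from integrability of `G'` on the open lower half plane
(Mathlib's Jacobian criterion); semialgebraicity of the primitives `A`, `B` on the closed bands and their
fibrewise derivatives.

References: J. Bochnak, M. Coste, M.-F. Roy, *Real Algebraic Geometry* (1998), §2.2; M. Kontsevich, D. Zagier,
*Periods* (2001), §1.2. No definitions, no named facts.
-/
noncomputable section

open Set MeasureTheory Filter Topology
open Literature.NumberTheory.Transcendental Literature.ModelTheory.ExponentialFields

namespace Summit.KontsevichZagierPeriods.HeckeMultiplicityOne.ManinStokes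

/-! ## Semialgebraic, measure-theoretic and analytic bookkeeping for the rectangle `(−1,1) × [0,1]` -/

section Bookkeeping

variable {x y xd yd : ℝ → ℝ} {G : ℂ → ℂ}

/-- `w ↦ x(w i)` is `ℚ`-semialgebraic on any `ℚ`-semialgebraic set where `|w i| < 1`. [folklore] -/
theorem isSemialgebraicFunOn_xMap (hx : ∀ t, x t = t / (1 - t ^ 2)) (i : Fin 2) {S : Set (Fin 2 → ℝ)}
    (hS : IsSemialgebraic ℚ S) (hSi : ∀ w ∈ S, w i ∈ Ioo (-1 : ℝ) 1) :
    IsSemialgebraicFunOn ℚ S (fun w => x (w i)) := by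
  have h := isSemialgebraicFunOn_aeval_div_aeval hS (MvPolynomial.X i)
    (1 - MvPolynomial.X i ^ 2 : MvPolynomial (Fin 2) ℚ) (fun w hw => by
      simpa using (one_sub_sq_pos (hSi w hw)).ne')
  refine h.congr fun w _ => ?_
  simp [hx]

/-- `w ↦ x'(w i) = (1 + w i²)/(1 − w i²)²` is `ℚ`-semialgebraic where `|w i| < 1`. [folklore] -/
theorem isSemialgebraicFunOn_xdMap (hxd : ∀ t, xd t = (1 + t ^ 2) / (1 - t ^ 2) ^ 2) (i : Fin 2)
    {S : Set (Fin 2 → ℝ)} (hS : IsSemialgebraic ℚ S) (hSi : ∀ w ∈ S, w i ∈ Ioo (-1 : ℝ) 1) :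
    IsSemialgebraicFunOn ℚ S (fun w => xd (w i)) := by
  have h := isSemialgebraicFunOn_aeval_div_aeval hS (1 + MvPolynomial.X i ^ 2)
    ((1 - MvPolynomial.X i ^ 2) ^ 2 : MvPolynomial (Fin 2) ℚ) (fun w hw => by
      simpa using (one_sub_sq_pos (hSi w hw)).ne')
  refine h.congr fun w _ => ?_
  simp [hxd]

/-- `w ↦ y(w j)` is `ℚ`-semialgebraic where `w j ≠ 1`. [folklore] -/
theorem isSemialgebraicFunOn_yMap (hy : ∀ s, y s = -s / (1 - s)) (j : Fin 2) {S : Set (Fin 2 → ℝ)}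
    (hS : IsSemialgebraic ℚ S) (hSj : ∀ w ∈ S, w j ≠ 1) :
    IsSemialgebraicFunOn ℚ S (fun w => y (w j)) := by
  have h := isSemialgebraicFunOn_aeval_div_aeval hS (-MvPolynomial.X j)
    (1 - MvPolynomial.X j : MvPolynomial (Fin 2) ℚ) (fun w hw => by
      simpa [sub_eq_zero] using Ne.symm (hSj w hw))
  refine h.congr fun w _ => ?_
  simp [hy]

/-- `w ↦ y'(w j) = −1/(1 − w j)²` is `ℚ`-semialgebraic where `w j ≠ 1`. [folklore] -/
theorem isSemialgebraicFunOn_ydMap (hyd : ∀ s, yd s = -1 / (1 - s) ^ 2) (j : Fin 2) {S : Set (Fin 2 → ℝ)}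
    (hS : IsSemialgebraic ℚ S) (hSj : ∀ w ∈ S, w j ≠ 1) :
    IsSemialgebraicFunOn ℚ S (fun w => yd (w j)) := by
  have h := isSemialgebraicFunOn_aeval_div_aeval hS (-1)
    ((1 - MvPolynomial.X j) ^ 2 : MvPolynomial (Fin 2) ℚ) (fun w hw => by
      simpa [sub_eq_zero] using Ne.symm (hSj w hw))
  refine h.congr fun w _ => ?_
  simp [hyd]

/-- **Composition with the product map**: if `F` is `ℚ`-semialgebraic on the punctured closed lower half
plane (as a subset of `ℝ²`), then `w ↦ F(x(w i), y(w j))` is `ℚ`-semialgebraic on any `ℚ`-semialgebraic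
`S` on which `|w i| < 1`, `w j ∈ [0, 1)` and the image avoids the punctures. [cite: BochnakCosteRoy1998, Prop. 2.2.6] -/
theorem isSemialgebraicFunOn_comp_productMap (hx : ∀ t, x t = t / (1 - t ^ 2)) (hy : ∀ s, y s = -s / (1 - s))
    (i j : Fin 2) {F : (Fin 2 → ℝ) → ℝ}
    (hF : IsSemialgebraicFunOn ℚ {w : Fin 2 → ℝ | w 1 ≤ 0 ∧ ¬(w 0 = 0 ∧ w 1 = 0) ∧ ¬(w 0 = 1728 ∧ w 1 = 0)} F)
    {S : Set (Fin 2 → ℝ)} (hS : IsSemialgebraic ℚ S) (hSi : ∀ w ∈ S, w i ∈ Ioo (-1 : ℝ) 1)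
    (hSj : ∀ w ∈ S, w j ∈ Ico (0 : ℝ) 1)
    (hSmap : ∀ w ∈ S, ¬(x (w i) = 0 ∧ y (w j) = 0) ∧ ¬(x (w i) = 1728 ∧ y (w j) = 0)) :
    IsSemialgebraicFunOn ℚ S (fun w => F ![x (w i), y (w j)]) := by
  have hmap : IsSemialgebraicMapOn ℚ S (fun w => (![x (w i), y (w j)] : Fin 2 → ℝ)) := by
    refine IsSemialgebraicMapOn.of_forall hS fun l => ?_
    fin_cases l
    · simpa using isSemialgebraicFunOn_xMap hx i hS hSi
    · simpa using isSemialgebraicFunOn_yMap hy j hS fun w hw => (hSj w hw).2.ne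
  refine IsSemialgebraicFunOn.comp_isSemialgebraicMapOn_holds hF hmap fun w hw => ?_
  refine ⟨?_, ?_, ?_⟩
  · simpa using yMap_nonpos hy (hSj w hw)
  · simpa using (hSmap w hw).1
  · simpa using (hSmap w hw).2

/-- The coordinate swap of `ℝ²` is a `ℚ`-semialgebraic map. [folklore] -/
theorem isSemialgebraicMapOn_swap {S : Set (Fin 2 → ℝ)} (hS : IsSemialgebraic ℚ S) :
    IsSemialgebraicMapOn ℚ S (fun w : Fin 2 → ℝ => fun l => w (Equiv.swap (0 : Fin 2) 1 l)) := by
  refine IsSemialgebraicMapOn.of_forall hS fun l => ?_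
  exact (isSemialgebraicFunOn_aeval hS (MvPolynomial.X (Equiv.swap (0 : Fin 2) 1 l))).congr
    fun w _ => by simp

end Bookkeeping

section ChangeOfVariables

variable {x y xd yd : ℝ → ℝ} {G : ℂ → ℂ} {g : (Fin 2 → ℝ) → ℝ}

/-- The open rectangle `(−1, 1) × (0, 1)` is measurable. [folklore] -/
theorem measurableSet_rect : MeasurableSet {w : Fin 2 → ℝ | w 0 ∈ Ioo (-1 : ℝ) 1 ∧ w 1 ∈ Ioo (0 : ℝ) 1} :=
  (measurableSet_Ioo.preimage (measurable_pi_apply 0)).inter (measurableSet_Ioo.preimage (measurable_pi_apply 1))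

/-- The derivative of a complex-differentiable function is continuous on an open set of
differentiability. [folklore] -/
theorem continuousOn_deriv_of_differentiableOn {U : Set ℂ} (hU : IsOpen U) (hGd : DifferentiableOn ℂ G U) :
    ContinuousOn (deriv G) U :=
  (hGd.contDiffOn (n := 1) hU).continuousOn_deriv_of_isOpen hU le_rfl

/-- **Integrability of the two-dimensional Green integrand on the rectangle**: with
`g(t, s) = −im G'(x(t) + i y(s)) · y'(s) · x'(t)`, integrability of `G'` on the open lower half plane
gives integrability of `g` on `(−1,1) × (0,1)` (the product substitution `u = x(t) + i y(s)`, Mathlib's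
Jacobian criterion `integrableOn_image_iff_integrableOn_abs_det_fderiv_smul`). [folklore] -/
theorem integrableOn_green_integrand (hx : ∀ t, x t = t / (1 - t ^ 2))
    (hxd : ∀ t, xd t = (1 + t ^ 2) / (1 - t ^ 2) ^ 2) (hy : ∀ s, y s = -s / (1 - s))
    (hyd : ∀ s, yd s = -1 / (1 - s) ^ 2)
    (hGd : DifferentiableOn ℂ G {u : ℂ | u.im < 0})
    (hGint : IntegrableOn (fun w : Fin 2 → ℝ => deriv G ((w 0 : ℂ) + (w 1 : ℂ) * Complex.I)) {w | w 1 < 0})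
    (hg : ∀ w, g w = -(deriv G ((x (w 0) : ℂ) + (y (w 1) : ℂ) * Complex.I)).im * yd (w 1) * xd (w 0)) :
    IntegrableOn g {w : Fin 2 → ℝ | w 0 ∈ Ioo (-1 : ℝ) 1 ∧ w 1 ∈ Ioo (0 : ℝ) 1} := by
  set O := {w : Fin 2 → ℝ | w 0 ∈ Ioo (-1 : ℝ) 1 ∧ w 1 ∈ Ioo (0 : ℝ) 1} with hO
  have hOm : MeasurableSet O := measurableSet_rect
  -- the product map and its (diagonal) derivative
  set Φ : (Fin 2 → ℝ) → (Fin 2 → ℝ) := fun w => ![x (w 0), y (w 1)] with hΦ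
  set Φ' : (Fin 2 → ℝ) → (Fin 2 → ℝ) →L[ℝ] (Fin 2 → ℝ) := fun w =>
    LinearMap.toContinuousLinearMap (Matrix.toLin' (Matrix.diagonal ![xd (w 0), yd (w 1)])) with hΦ'
  have hΦ'apply : ∀ w v : Fin 2 → ℝ, Φ' w v = ![xd (w 0) * v 0, yd (w 1) * v 1] := by
    intro w v
    simp only [hΦ', LinearMap.coe_toContinuousLinearMap', Matrix.toLin'_apply]
    ext i; fin_cases i <;> simp [Matrix.mulVec_diagonal]
  have hderiv : ∀ w ∈ O, HasFDerivWithinAt Φ (Φ' w) O w := by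
    intro w hw
    refine HasFDerivAt.hasFDerivWithinAt ?_
    rw [hasFDerivAt_pi', Fin.forall_fin_two]
    constructor
    · -- the component `x (w 0)`
      have h1 : HasFDerivAt (fun w : Fin 2 → ℝ => x (w 0))
          ((ContinuousLinearMap.smulRight (1 : ℝ →L[ℝ] ℝ) (xd (w 0))).comp (ContinuousLinearMap.proj 0)) w := by
        have hx' := (hasDerivAt_xMap hx hw.1).hasFDerivAt
        rw [← hxd] at hx'
        exact hx'.comp w (hasFDerivAt_apply 0 w)
      have hL : (ContinuousLinearMap.proj 0).comp (Φ' w) =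
          (ContinuousLinearMap.smulRight (1 : ℝ →L[ℝ] ℝ) (xd (w 0))).comp (ContinuousLinearMap.proj 0) := by
        ext v
        rw [ContinuousLinearMap.comp_apply, ContinuousLinearMap.comp_apply, hΦ'apply]
        simp [mul_comm]
      rw [hL]
      exact h1
    · have h1 : HasFDerivAt (fun w : Fin 2 → ℝ => y (w 1))
          ((ContinuousLinearMap.smulRight (1 : ℝ →L[ℝ] ℝ) (yd (w 1))).comp (ContinuousLinearMap.proj 1)) w := by
        have hy' := (hasDerivAt_yMap hy (ne_of_lt hw.2.2)).hasFDerivAt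
        rw [← hyd] at hy'
        exact hy'.comp w (hasFDerivAt_apply 1 w)
      have hL : (ContinuousLinearMap.proj 1).comp (Φ' w) =
          (ContinuousLinearMap.smulRight (1 : ℝ →L[ℝ] ℝ) (yd (w 1))).comp (ContinuousLinearMap.proj 1) := by
        ext v
        rw [ContinuousLinearMap.comp_apply, ContinuousLinearMap.comp_apply, hΦ'apply]
        simp [mul_comm]
      rw [hL]
      exact h1
  have hinj : InjOn Φ O := by
    intro w hw w' hw' h
    have h0 : x (w 0) = x (w' 0) := by simpa [hΦ] using congrFun h 0
    have h1 : y (w 1) = y (w' 1) := by simpa [hΦ] using congrFun h 1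
    have e0 : w 0 = w' 0 := (strictMonoOn_xMap hx).injOn hw.1 hw'.1 h0
    have e1 : w 1 = w' 1 :=
      (strictAntiOn_yMap hy).injOn ⟨hw.2.1.le, hw.2.2⟩ ⟨hw'.2.1.le, hw'.2.2⟩ h1
    ext i; fin_cases i
    · exact e0
    · exact e1
  have himage : Φ '' O ⊆ {w : Fin 2 → ℝ | w 1 < 0} := by
    rintro _ ⟨w, hw, rfl⟩
    simpa [hΦ] using yMap_neg hy hw.2
  have key := (integrableOn_image_iff_integrableOn_abs_det_fderiv_smul volume hOm hderiv hinj
    (fun w : Fin 2 → ℝ => deriv G ((w 0 : ℂ) + (w 1 : ℂ) * Complex.I))).mp (hGint.mono_set himage)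
  have hdet : ∀ w, (Φ' w).det = xd (w 0) * yd (w 1) := by
    intro w
    show LinearMap.det (Matrix.toLin' (Matrix.diagonal ![xd (w 0), yd (w 1)])) = _
    rw [LinearMap.det_toLin', Matrix.det_diagonal]
    simp [Fin.prod_univ_two]
  have hΦcx : ∀ w, ((Φ w 0 : ℝ) : ℂ) + ((Φ w 1 : ℝ) : ℂ) * Complex.I = (x (w 0) : ℂ) + (y (w 1) : ℂ) * Complex.I := by
    intro w; simp [hΦ]
  simp_rw [hdet, hΦcx] at key
  -- continuity of `g` on the open rectangle
  have hdc : ContinuousOn (deriv G) {u : ℂ | u.im < 0} :=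
    continuousOn_deriv_of_differentiableOn (isOpen_lt Complex.continuous_im continuous_const) hGd
  have hgc : ContinuousOn g O := by
    have hxc : ContinuousOn (fun w : Fin 2 → ℝ => x (w 0)) O := fun w hw =>
      (ContinuousAt.comp (f := fun p : Fin 2 → ℝ => p 0) (x := w)
        (hasDerivAt_xMap hx hw.1).continuousAt (continuous_apply 0).continuousAt).continuousWithinAt
    have hyc : ContinuousOn (fun w : Fin 2 → ℝ => y (w 1)) O := fun w hw =>
      (ContinuousAt.comp (f := fun p : Fin 2 → ℝ => p 1) (x := w)
        (hasDerivAt_yMap hy (ne_of_lt hw.2.2)).continuousAt (continuous_apply 1).continuousAt).continuousWithinAt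
    have hxdc : ContinuousOn (fun w : Fin 2 → ℝ => xd (w 0)) O := by
      have : (fun w : Fin 2 → ℝ => xd (w 0)) = fun w => (1 + w 0 ^ 2) / (1 - w 0 ^ 2) ^ 2 := funext fun w => hxd _
      rw [this]
      refine ContinuousOn.div (by fun_prop) (by fun_prop) fun w hw => pow_ne_zero _ (one_sub_sq_pos hw.1).ne'
    have hydc : ContinuousOn (fun w : Fin 2 → ℝ => yd (w 1)) O := by
      have : (fun w : Fin 2 → ℝ => yd (w 1)) = fun w => -1 / (1 - w 1) ^ 2 := funext fun w => hyd _
      rw [this]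
      refine ContinuousOn.div (by fun_prop) (by fun_prop) fun w hw => pow_ne_zero _ ?_
      exact sub_ne_zero.mpr (ne_of_gt hw.2.2)
    have hphi : ContinuousOn (fun w : Fin 2 → ℝ => (x (w 0) : ℂ) + (y (w 1) : ℂ) * Complex.I) O :=
      (Complex.continuous_ofReal.comp_continuousOn hxc).add
        ((Complex.continuous_ofReal.comp_continuousOn hyc).mul continuousOn_const)
    have hcomp : ContinuousOn (fun w : Fin 2 → ℝ => deriv G ((x (w 0) : ℂ) + (y (w 1) : ℂ) * Complex.I)) O :=
      hdc.comp hphi fun w hw => by simpa using yMap_neg hy hw.2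
    have heq : g = fun w => -(deriv G ((x (w 0) : ℂ) + (y (w 1) : ℂ) * Complex.I)).im * yd (w 1) * xd (w 0) :=
      funext hg
    rw [heq]
    exact ((Complex.continuous_im.comp_continuousOn hcomp).neg.mul hydc).mul hxdc
  refine Integrable.mono' key.norm (hgc.aestronglyMeasurable hOm) ?_
  rw [ae_restrict_iff' hOm]
  refine Eventually.of_forall fun w _ => ?_
  rw [hg, norm_smul, Real.norm_eq_abs, Real.norm_eq_abs, abs_abs, abs_mul, abs_mul, abs_neg, abs_mul]
  have h1 : |(deriv G ((x (w 0) : ℂ) + (y (w 1) : ℂ) * Complex.I)).im| ≤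
      ‖deriv G ((x (w 0) : ℂ) + (y (w 1) : ℂ) * Complex.I)‖ := Complex.abs_im_le_norm _
  calc |(deriv G ((x (w 0) : ℂ) + (y (w 1) : ℂ) * Complex.I)).im| * |yd (w 1)| * |xd (w 0)|
      ≤ ‖deriv G ((x (w 0) : ℂ) + (y (w 1) : ℂ) * Complex.I)‖ * |yd (w 1)| * |xd (w 0)| := by gcongr
    _ = |xd (w 0)| * |yd (w 1)| * ‖deriv G ((x (w 0) : ℂ) + (y (w 1) : ℂ) * Complex.I)‖ := by ring

end ChangeOfVariables

section MainGreen

variable {x y xd yd : ℝ → ℝ} {G : ℂ → ℂ} {A B g : (Fin 2 → ℝ) → ℝ}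

/-- The punctured base `τᵥ = (−1,1) ∖ {0, x⁻¹(1728)}` is `ℚ`-semialgebraic. [folklore] -/
theorem isSemialgebraic_baseV :
    IsSemialgebraic ℚ {t : Fin 1 → ℝ | t 0 ∈ Ioo (-1 : ℝ) 1 ∧ t 0 ≠ 0 ∧ 1728 * (1 - t 0 ^ 2) ≠ t 0} := by
  have h1 := isSemialgebraic_setOf_eval_pos (k := ℚ) (R := ℝ) (MvPolynomial.X (0 : Fin 1) + 1 : MvPolynomial (Fin 1) ℚ)
  have h2 := isSemialgebraic_setOf_eval_pos (k := ℚ) (R := ℝ) (1 - MvPolynomial.X (0 : Fin 1) : MvPolynomial (Fin 1) ℚ)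
  have h3 := isSemialgebraic_setOf_eval_ne_zero (k := ℚ) (R := ℝ) (MvPolynomial.X (0 : Fin 1) : MvPolynomial (Fin 1) ℚ)
  have h4 := isSemialgebraic_setOf_eval_ne_zero (k := ℚ) (R := ℝ)
    (MvPolynomial.C (1728 : ℚ) * (1 - MvPolynomial.X (0 : Fin 1) ^ 2) - MvPolynomial.X 0 : MvPolynomial (Fin 1) ℚ)
  have he : {t : Fin 1 → ℝ | t 0 ∈ Ioo (-1 : ℝ) 1 ∧ t 0 ≠ 0 ∧ 1728 * (1 - t 0 ^ 2) ≠ t 0} =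
      (({t : Fin 1 → ℝ | 0 < MvPolynomial.aeval t (MvPolynomial.X (0 : Fin 1) + 1 : MvPolynomial (Fin 1) ℚ)} ∩
        {t : Fin 1 → ℝ | 0 < MvPolynomial.aeval t (1 - MvPolynomial.X (0 : Fin 1) : MvPolynomial (Fin 1) ℚ)}) ∩
        {t : Fin 1 → ℝ | MvPolynomial.aeval t (MvPolynomial.X (0 : Fin 1) : MvPolynomial (Fin 1) ℚ) ≠ 0}) ∩
        {t : Fin 1 → ℝ | MvPolynomial.aeval t (MvPolynomial.C (1728 : ℚ) * (1 - MvPolynomial.X (0 : Fin 1) ^ 2) -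
          MvPolynomial.X 0 : MvPolynomial (Fin 1) ℚ) ≠ 0} := by
    ext t
    simp only [mem_setOf_eq, mem_inter_iff, mem_Ioo, map_add, map_sub, map_mul, map_pow, MvPolynomial.aeval_X,
      map_one, MvPolynomial.aeval_C, eq_ratCast, Rat.cast_ofNat, ne_eq, sub_eq_zero]
    constructor
    · rintro ⟨⟨h1, h2⟩, h3, h4⟩; exact ⟨⟨⟨by linarith, by linarith⟩, h3⟩, h4⟩
    · rintro ⟨⟨⟨h1, h2⟩, h3⟩, h4⟩; exact ⟨⟨by linarith, by linarith⟩, h3, h4⟩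
  rw [he]
  exact ((h1.inter h2).inter h3).inter h4

/-- The base `τₕ = (0,1)` is `ℚ`-semialgebraic. [folklore] -/
theorem isSemialgebraic_baseH : IsSemialgebraic ℚ {s : Fin 1 → ℝ | s 0 ∈ Ioo (0 : ℝ) 1} := by
  have h1 := isSemialgebraic_setOf_eval_pos (k := ℚ) (R := ℝ) (MvPolynomial.X (0 : Fin 1) : MvPolynomial (Fin 1) ℚ)
  have h2 := isSemialgebraic_setOf_eval_pos (k := ℚ) (R := ℝ) (1 - MvPolynomial.X (0 : Fin 1) : MvPolynomial (Fin 1) ℚ)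
  have he : {s : Fin 1 → ℝ | s 0 ∈ Ioo (0 : ℝ) 1} =
      {t : Fin 1 → ℝ | 0 < MvPolynomial.aeval t (MvPolynomial.X (0 : Fin 1) : MvPolynomial (Fin 1) ℚ)} ∩
        {t : Fin 1 → ℝ | 0 < MvPolynomial.aeval t (1 - MvPolynomial.X (0 : Fin 1) : MvPolynomial (Fin 1) ℚ)} := by
    ext t; simp [sub_pos]
  rw [he]; exact h1.inter h2

/-- Constant functions with an integer value are `ℚ`-semialgebraic. [folklore] -/
theorem isSemialgebraicFunOn_const_int {m : ℕ} {S : Set (Fin m → ℝ)} (hS : IsSemialgebraic ℚ S) (c : ℤ) :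
    IsSemialgebraicFunOn ℚ S (fun _ => (c : ℝ)) :=
  (isSemialgebraicFunOn_aeval hS (MvPolynomial.C (c : ℚ))).congr fun w _ => by simp

/-- **Derivative of the vertical primitive along a fibre.** [folklore] -/
theorem hasDerivAt_verticalPrimitive (hy : ∀ s, y s = -s / (1 - s)) (hyd : ∀ s, yd s = -1 / (1 - s) ^ 2)
    (hGd : DifferentiableOn ℂ G {u : ℂ | u.im < 0})
    (hA : ∀ w, A w = if w 1 < 1 then (G ((x (w 0) : ℂ) + (y (w 1) : ℂ) * Complex.I)).re * xd (w 0) else 0)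
    (hg : ∀ w, g w = -(deriv G ((x (w 0) : ℂ) + (y (w 1) : ℂ) * Complex.I)).im * yd (w 1) * xd (w 0))
    (t : Fin 1 → ℝ) {s : ℝ} (hs : s ∈ Ioo (0 : ℝ) 1) :
    HasDerivAt (fun s' : ℝ => A (Fin.snoc t s')) (g (Fin.snoc t s)) s := by
  have hGat : DifferentiableAt ℂ G ((x (t 0) : ℂ) + (y s : ℂ) * Complex.I) :=
    hGd.differentiableAt ((isOpen_lt Complex.continuous_im continuous_const).mem_nhds (phi_im_neg hy _ hs))
  have h := hasDerivAt_re_G_vertical hy (x (t 0)) (xd (t 0)) (ne_of_lt hs.2) hGat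
  rw [hg, snoc_zero, snoc_one, hyd]
  refine h.congr_of_eventuallyEq ?_
  filter_upwards [Iio_mem_nhds hs.2] with s' hs'
  rw [hA, snoc_one, snoc_zero, if_pos (show s' < 1 from hs')]

/-- **Derivative of the horizontal primitive along a fibre.** [folklore] -/
theorem hasDerivAt_horizontalPrimitive (hx : ∀ t, x t = t / (1 - t ^ 2)) (hxd : ∀ t, xd t = (1 + t ^ 2) / (1 - t ^ 2) ^ 2)
    (hy : ∀ s, y s = -s / (1 - s))
    (hGd : DifferentiableOn ℂ G {u : ℂ | u.im < 0})
    (hB : ∀ w, B w = if w 1 ∈ Ioo (-1 : ℝ) 1 then -(G ((x (w 1) : ℂ) + (y (w 0) : ℂ) * Complex.I)).im * yd (w 0) else 0)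
    (hg : ∀ w, g w = -(deriv G ((x (w 0) : ℂ) + (y (w 1) : ℂ) * Complex.I)).im * yd (w 1) * xd (w 0))
    (s : Fin 1 → ℝ) (hs : s 0 ∈ Ioo (0 : ℝ) 1) {t : ℝ} (ht : t ∈ Ioo (-1 : ℝ) 1) :
    HasDerivAt (fun t' : ℝ => B (Fin.snoc s t'))
      (g (fun l => (Fin.snoc s t : Fin 2 → ℝ) (Equiv.swap (0 : Fin 2) 1 l))) t := by
  have hGat : DifferentiableAt ℂ G ((x t : ℂ) + (y (s 0) : ℂ) * Complex.I) :=
    hGd.differentiableAt ((isOpen_lt Complex.continuous_im continuous_const).mem_nhds (phi_im_neg hy _ hs))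
  have h := hasDerivAt_im_G_horizontal hx (y (s 0)) (yd (s 0)) ht hGat
  have hval : g (fun l => (Fin.snoc s t : Fin 2 → ℝ) (Equiv.swap (0 : Fin 2) 1 l)) =
      -(deriv G ((x t : ℂ) + (y (s 0) : ℂ) * Complex.I)).im * ((1 + t ^ 2) / (1 - t ^ 2) ^ 2) * yd (s 0) := by
    rw [hg]
    simp only [Equiv.swap_apply_left, Equiv.swap_apply_right, snoc_one, snoc_zero, hxd]
    ring
  rw [hval]
  refine h.congr_of_eventuallyEq ?_
  filter_upwards [isOpen_Ioo.mem_nhds ht] with t' ht'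
  rw [hB, snoc_one, snoc_zero, if_pos ht']

/-- **The vertical primitive is `ℚ`-semialgebraic on the closed vertical band.** [cite: BochnakCosteRoy1998, Prop. 2.2.6] -/
theorem isSemialgebraicFunOn_verticalPrimitive (hx : ∀ t, x t = t / (1 - t ^ 2))
    (hxd : ∀ t, xd t = (1 + t ^ 2) / (1 - t ^ 2) ^ 2) (hy : ∀ s, y s = -s / (1 - s))
    (hGre : IsSemialgebraicFunOn ℚ {w : Fin 2 → ℝ | w 1 ≤ 0 ∧ ¬(w 0 = 0 ∧ w 1 = 0) ∧ ¬(w 0 = 1728 ∧ w 1 = 0)}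
      (fun w => (G ((w 0 : ℂ) + (w 1 : ℂ) * Complex.I)).re))
    (hA : ∀ w, A w = if w 1 < 1 then (G ((x (w 0) : ℂ) + (y (w 1) : ℂ) * Complex.I)).re * xd (w 0) else 0) :
    IsSemialgebraicFunOn ℚ (KZlog.band {t : Fin 1 → ℝ | t 0 ∈ Ioo (-1 : ℝ) 1 ∧ t 0 ≠ 0 ∧ 1728 * (1 - t 0 ^ 2) ≠ t 0}
      (fun _ => 0) (fun _ => 1)) A := by
  set τv := {t : Fin 1 → ℝ | t 0 ∈ Ioo (-1 : ℝ) 1 ∧ t 0 ≠ 0 ∧ 1728 * (1 - t 0 ^ 2) ≠ t 0} with hτv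
  have hτ : IsSemialgebraic ℚ τv := isSemialgebraic_baseV
  have hband : IsSemialgebraic ℚ (KZlog.band τv (fun _ => 0) (fun _ => 1)) :=
    KZlog.isSemialgebraic_band (isSemialgebraicFunOn_const_int hτ 0 |>.congr fun _ _ => by simp)
      (isSemialgebraicFunOn_const_int hτ 1 |>.congr fun _ _ => by simp)
  have hlt : IsSemialgebraic ℚ {w : Fin 2 → ℝ | w 1 < 1} := by
    have h := isSemialgebraic_setOf_eval_pos (k := ℚ) (R := ℝ) (1 - MvPolynomial.X (1 : Fin 2) : MvPolynomial (Fin 2) ℚ)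
    have he : {w : Fin 2 → ℝ | w 1 < 1} = {w | 0 < MvPolynomial.aeval w (1 - MvPolynomial.X (1 : Fin 2) : MvPolynomial (Fin 2) ℚ)} := by
      ext w; simp [sub_pos]
    rw [he]; exact h
  set S1 := KZlog.band τv (fun _ => 0) (fun _ => 1) ∩ {w : Fin 2 → ℝ | w 1 < 1} with hS1
  set S2 := KZlog.band τv (fun _ => 0) (fun _ => 1) \ {w : Fin 2 → ℝ | w 1 < 1} with hS2
  have hS1s : IsSemialgebraic ℚ S1 := hband.inter hlt
  have hS2s : IsSemialgebraic ℚ S2 := hband.diff hlt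
  have hmem1 : ∀ w ∈ S1, w 0 ∈ Ioo (-1 : ℝ) 1 ∧ w 0 ≠ 0 ∧ 1728 * (1 - w 0 ^ 2) ≠ w 0 ∧ w 1 ∈ Ico (0 : ℝ) 1 := by
    rintro w ⟨⟨hτw, h0, _⟩, h1⟩
    exact ⟨hτw.1, hτw.2.1, hτw.2.2, ⟨hτw.1.1.le.trans_eq rfl |> fun _ => h0, h1⟩⟩
  have hF1 : IsSemialgebraicFunOn ℚ S1 (fun w => (G ((x (w 0) : ℂ) + (y (w 1) : ℂ) * Complex.I)).re * xd (w 0)) := by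
    have hc := isSemialgebraicFunOn_comp_productMap hx hy 0 1 hGre hS1s (fun w hw => (hmem1 w hw).1)
      (fun w hw => (hmem1 w hw).2.2.2) (fun w hw => by
        obtain ⟨hw0, hne, hroot, _⟩ := hmem1 w hw
        refine ⟨fun h => hne ((xMap_eq_zero_iff hx hw0).mp h.1), fun h => hroot ((xMap_eq_iff hx hw0 1728).mp h.1)⟩)
    have hc' : IsSemialgebraicFunOn ℚ S1 (fun w => (G ((x (w 0) : ℂ) + (y (w 1) : ℂ) * Complex.I)).re) :=
      hc.congr fun w _ => by simp
    exact IsSemialgebraicFunOn.mul_holds hc' (isSemialgebraicFunOn_xdMap hxd 0 hS1s fun w hw => (hmem1 w hw).1)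
  have hF2 : IsSemialgebraicFunOn ℚ S2 (fun _ => (0 : ℝ)) := isSemialgebraicFunOn_const_int hS2s 0 |>.congr
    fun _ _ => by simp
  have hu : S1 ∪ S2 = KZlog.band τv (fun _ => 0) (fun _ => 1) := Set.inter_union_sdiff _ _
  rw [← hu]
  refine IsSemialgebraicFunOn.union hF1 hF2 (fun w hw => ?_) (fun w hw => ?_)
  · rw [hA, if_pos (show w 1 < 1 from hw.2)]
  · rw [hA, if_neg (show ¬ w 1 < 1 from hw.2)]

/-- **The horizontal primitive is `ℚ`-semialgebraic on the closed horizontal band.** [cite: BochnakCosteRoy1998, Prop. 2.2.6] -/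
theorem isSemialgebraicFunOn_horizontalPrimitive (hx : ∀ t, x t = t / (1 - t ^ 2)) (hy : ∀ s, y s = -s / (1 - s))
    (hyd : ∀ s, yd s = -1 / (1 - s) ^ 2)
    (hGim : IsSemialgebraicFunOn ℚ {w : Fin 2 → ℝ | w 1 ≤ 0 ∧ ¬(w 0 = 0 ∧ w 1 = 0) ∧ ¬(w 0 = 1728 ∧ w 1 = 0)}
      (fun w => (G ((w 0 : ℂ) + (w 1 : ℂ) * Complex.I)).im))
    (hB : ∀ w, B w = if w 1 ∈ Ioo (-1 : ℝ) 1 then -(G ((x (w 1) : ℂ) + (y (w 0) : ℂ) * Complex.I)).im * yd (w 0) else 0) :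
    IsSemialgebraicFunOn ℚ (KZlog.band {s : Fin 1 → ℝ | s 0 ∈ Ioo (0 : ℝ) 1} (fun _ => -1) (fun _ => 1)) B := by
  set τh := {s : Fin 1 → ℝ | s 0 ∈ Ioo (0 : ℝ) 1} with hτh
  have hτ : IsSemialgebraic ℚ τh := isSemialgebraic_baseH
  have hband : IsSemialgebraic ℚ (KZlog.band τh (fun _ => -1) (fun _ => 1)) :=
    KZlog.isSemialgebraic_band (isSemialgebraicFunOn_const_int hτ (-1) |>.congr fun _ _ => by simp)
      (isSemialgebraicFunOn_const_int hτ 1 |>.congr fun _ _ => by simp)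
  have hioo : IsSemialgebraic ℚ {w : Fin 2 → ℝ | w 1 ∈ Ioo (-1 : ℝ) 1} := by
    have h1 := isSemialgebraic_setOf_eval_pos (k := ℚ) (R := ℝ) (MvPolynomial.X (1 : Fin 2) + 1 : MvPolynomial (Fin 2) ℚ)
    have h2 := isSemialgebraic_setOf_eval_pos (k := ℚ) (R := ℝ) (1 - MvPolynomial.X (1 : Fin 2) : MvPolynomial (Fin 2) ℚ)
    have he : {w : Fin 2 → ℝ | w 1 ∈ Ioo (-1 : ℝ) 1} =
        {w | 0 < MvPolynomial.aeval w (MvPolynomial.X (1 : Fin 2) + 1 : MvPolynomial (Fin 2) ℚ)} ∩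
          {w | 0 < MvPolynomial.aeval w (1 - MvPolynomial.X (1 : Fin 2) : MvPolynomial (Fin 2) ℚ)} := by
      ext w
      simp only [mem_setOf_eq, mem_Ioo, mem_inter_iff, map_add, MvPolynomial.aeval_X, map_one, map_sub, sub_pos]
      constructor
      · rintro ⟨h1, h2⟩; exact ⟨by linarith, h2⟩
      · rintro ⟨h1, h2⟩; exact ⟨by linarith, h2⟩
    rw [he]; exact h1.inter h2
  set S1 := KZlog.band τh (fun _ => -1) (fun _ => 1) ∩ {w : Fin 2 → ℝ | w 1 ∈ Ioo (-1 : ℝ) 1} with hS1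
  set S2 := KZlog.band τh (fun _ => -1) (fun _ => 1) \ {w : Fin 2 → ℝ | w 1 ∈ Ioo (-1 : ℝ) 1} with hS2
  have hS1s : IsSemialgebraic ℚ S1 := hband.inter hioo
  have hS2s : IsSemialgebraic ℚ S2 := hband.diff hioo
  have hmem1 : ∀ w ∈ S1, w 1 ∈ Ioo (-1 : ℝ) 1 ∧ w 0 ∈ Ioo (0 : ℝ) 1 := by
    rintro w ⟨⟨hτw, _, _⟩, h1⟩
    exact ⟨h1, hτw⟩
  have hF1 : IsSemialgebraicFunOn ℚ S1 (fun w => -(G ((x (w 1) : ℂ) + (y (w 0) : ℂ) * Complex.I)).im * yd (w 0)) := by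
    have hc := isSemialgebraicFunOn_comp_productMap hx hy 1 0 hGim hS1s (fun w hw => (hmem1 w hw).1)
      (fun w hw => ⟨(hmem1 w hw).2.1.le, (hmem1 w hw).2.2⟩) (fun w hw => by
        have hneg := yMap_neg hy (hmem1 w hw).2
        exact ⟨fun h => hneg.ne h.2, fun h => hneg.ne h.2⟩)
    have hc' : IsSemialgebraicFunOn ℚ S1 (fun w => (G ((x (w 1) : ℂ) + (y (w 0) : ℂ) * Complex.I)).im) :=
      hc.congr fun w _ => by simp
    have := IsSemialgebraicFunOn.mul_holds hc'.neg (isSemialgebraicFunOn_ydMap hyd 0 hS1s fun w hw =>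
      (hmem1 w hw).2.2.ne)
    exact this.congr fun w _ => by simp
  have hF2 : IsSemialgebraicFunOn ℚ S2 (fun _ => (0 : ℝ)) := isSemialgebraicFunOn_const_int hS2s 0 |>.congr
    fun _ _ => by simp
  have hu : S1 ∪ S2 = KZlog.band τh (fun _ => -1) (fun _ => 1) := Set.inter_union_sdiff _ _
  rw [← hu]
  refine IsSemialgebraicFunOn.union hF1 hF2 (fun w hw => ?_) (fun w hw => ?_)
  · rw [hB, if_pos (show w 1 ∈ Ioo (-1 : ℝ) 1 from hw.2)]
  · rw [hB, if_neg (show w 1 ∉ Ioo (-1 : ℝ) 1 from hw.2)]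

end MainGreen

end Summit.KontsevichZagierPeriods.HeckeMultiplicityOne.ManinStokes
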